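import Summits.QuantumFields.Balaban3D.Proofs.FluctChartSU2
import Summits.QuantumFields.Balaban3D.Proofs.ChartScalingSU2
import Summits.QuantumFields.Balaban3D.Proofs.GaussianNormalization

/-!
# `Summit.QuantumFields.Balaban3D.Proofs.FluctGaussSU2` — THE RIGHT-HAND SIDE OF [Balaban1985UV3] (22) p. 261 FOR THE LANE'S AVERAGING AT
# `Ω₁ = T`, `G = SU(2)`, AS AN IDENTITY: the gauge-fixed fluctuation integral around a background equals
# `e^{−S(U₁)} · σ₀^{|T*|} · g₀^{3|T*|} · Z · ∫ dμ Ψ` with `dμ = Z⁻¹e^{−q}dA′` the normalised Gaussian of ANY measurable quadratic datum `q = q(V)`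
# (print: `½⟨A, Δ(U₁)A⟩`, (19)/(22)), `σ₀ = σ(0) = (2π²)⁻¹`, and the FLUCTUATION INTEGRAND `Ψ = χ · Π_b (σ(g₀A′_b)/σ₀) · exp[−(S(U′(g₀A′)U₁) −
# S(U₁)) + q(A′)]` — print's «χ exp[v(g₀A) − (1/g₀²)Ṽ(g₀A)]» with `v` = (21) (the `log σ/σ₀` terms; (20)'s determinant is absent: `D̃ ≡ 0` for the
# decimation average) and `Ṽ` DEFINED as the exact remainder of (19) (seat p4, lane `pub-balaban3d`; step (S3) of HOME/drafts/p4/FIBRE49.md)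

HONEST FRAMING (lane PLAN.md §0, binding): see `…Proofs.SectAFirstStep`.  [folklore] finite-dimensional change of variables: `…FluctChartSU2`
(free bonds + exp chart), `…ChartScalingSU2` (density + scaling), `…GaussianNormalization` (Z and dμ); nothing of the paper is asserted — in
particular NOT that `Ṽ` starts at third order (that is print's (19) about the minimizer `U₁`, binder b11) nor any bound on `∫ dμ Ψ` ((24), p5's rows).
-/

noncomputable section

namespace Summit.QuantumFields.Balaban3D.Proofs.FluctGaussSU2

open _root_.MeasureTheory Metric
open Literature.MathematicalPhysics.QuantumFieldTheory.Balaban1983to89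
open Literature.MathematicalPhysics.QuantumFieldTheory.Balaban1983to89.T4HaarSU2ExpChart (expPoint expMeasure expWeight measurable_expPoint
  measurable_expWeight expWeight_nonneg expWeight_pos)
open Summit.QuantumFields.Balaban3D.Carriers
open Summit.QuantumFields.Balaban3D.Proofs.AxialGauge
open Summit.QuantumFields.Balaban3D.Proofs.AxialGaugeFix
open Summit.QuantumFields.Balaban3D.Proofs.AxialGaugeShift
open Summit.QuantumFields.Balaban3D.Proofs.ProductChartSU2 (SU2)
open Summit.QuantumFields.Balaban3D.Proofs.FluctChartSU2
open Summit.QuantumFields.Balaban3D.Proofs.FibreSplit (splitEquiv)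
open Summit.QuantumFields.Balaban3D.Proofs.ChartScalingSU2 (E3 integral_pi_expMeasure integral_comp_smul_E3)
open Summit.QuantumFields.Balaban3D.Proofs.GaussianNormalization (partZ normalized integral_exp_neg_mul_eq)

variable {P : Params} {j : ℕ} [DecidableEq (PBond P j)]

/-- The FREE bonds (print's `|Ω₁*|` variables at `Ω₁ = T`). -/
abbrev Free (P : Params) (j : ℕ) [DecidableEq (PBond P j)] : Type := {b : PBond P j // ¬ IsDummy b}

/-- `σ₀ = σ(0)` — the Haar density at the origin of the chart (`= (2π²)⁻¹` for SU(2), `…ChartSU2.sigma0_su2`). [cite: Balaban1985UV3, p.260 L19] -/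
def sigma0 : ℝ := expWeight 0

/-- `σ₀ > 0`. [folklore] -/
theorem sigma0_pos : 0 < sigma0 := expWeight_pos (by simp [Real.pi_pos])

/-- THE FIELD IN THE SCALED CHART: `U(V, A′) := U′(g₀A′) · U₁(V)` bondwise, `U′(A) = fluctFree (exp ∘ A)` (`1` on forest ∪ crossing bonds).
[cite: Balaban1985UV3, (13) p.259 + (22) p.261] -/
def fieldAt (U₁ : GaugeField P (j + 1) SU2 → GaugeField P j SU2) (g₀ : ℝ) (V : GaugeField P (j + 1) SU2) (A : Free P j → E3) :
    GaugeField P j SU2 :=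
  fun b => fluctFree (fun i => expPoint ((g₀ • A) i)) b * U₁ V b

/-- THE FLUCTUATION INTEGRAND of (22): `Ψ_V(A′) = 𝟙{‖g₀A′_b‖ < π ∀b} · χ(U(V,A′)) · Π_b σ(g₀A′_b)/σ₀ · exp[−(S(U(V,A′)) − S(U₁(V))) + q_V(A′)]`
(print's `χ exp[v(g₀A) − (1/g₀²)Ṽ(g₀A)]`, `v` = (21), `Ṽ` := the exact remainder of (19) relative to the quadratic datum `q_V`). [cite: Balaban1985UV3, (19)–(22) p.261] -/
def fluctIntegrand (S χ : GaugeField P j SU2 → ℝ) (q : GaugeField P (j + 1) SU2 → (Free P j → E3) → ℝ)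
    (U₁ : GaugeField P (j + 1) SU2 → GaugeField P j SU2) (g₀ : ℝ) (V : GaugeField P (j + 1) SU2) (A : Free P j → E3) : ℝ :=
  (Set.univ.pi fun _ : Free P j => ball (0 : E3) Real.pi).indicator (fun _ => (1 : ℝ)) (g₀ • A) * χ (fieldAt U₁ g₀ V A) *
    (∏ i, expWeight ((g₀ • A) i) / sigma0) * Real.exp (-(S (fieldAt U₁ g₀ V A) - S (U₁ V)) + q V A)

omit [DecidableEq (PBond P j)] in
/-- Bookkeeping: `Π_b σ(x_b) = σ₀^{N} · Π_b (σ(x_b)/σ₀)`. [folklore] -/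
theorem prod_expWeight_eq {ι : Type*} [Fintype ι] (x : ι → E3) :
    ∏ i, expWeight (x i) = sigma0 ^ Fintype.card ι * ∏ i, expWeight (x i) / sigma0 := by
  rw [Finset.prod_div_distrib, Finset.prod_const, Finset.card_univ, mul_div_cancel₀]
  exact pow_ne_zero _ sigma0_pos.ne'

/-- **(22), RIGHT-HAND SIDE, FOR THE LANE'S AVERAGING AT Ω₁ = T AND G = SU(2).**  Standing range; `S` (print: `A(·)/g₀²`) measurable and
non-negative, `χ` measurable with `|χ| ≤ 1`, a background selection `U₁`, `g₀ > 0`, and per coarse field a measurable quadratic datum `q_V` with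
`0 < Z(V) = ∫ e^{−q_V} dA′` (print: `½⟨A′, Δ(U₁)A′⟩`, binder b9/(54) for `Δ > 0`).  THEN the fluctuation integral of `U ↦ χ(U)e^{−S(U)}` around `U₁(V)`
over the gauge-fixed fibre equals `e^{−S(U₁ V)} · σ₀^{|T*|} · g₀^{3|T*|} · Z(V) · ∫ Ψ_V dμ_V`, `dμ_V = Z(V)⁻¹ e^{−q_V} dA′`, `|T*|` = #free bonds.  Combined with
`AxialGaugeShift.rnTransport_ae_eq_integral_fluct` (gauge-invariant integrand, `U₁` axial with `Ū₁ = V`) this is `(T[χe^{−S}])(V)` dV-a.e.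
[cite: Balaban1985UV3, (22) p.261] -/
theorem fluct_integral_eq_gauss (hj : j + 1 ≤ P.m + P.K) (S χ : GaugeField P j SU2 → ℝ) (hSm : Measurable S) (hS0 : ∀ U, 0 ≤ S U)
    (hχm : Measurable χ) (hχb : ∀ U, |χ U| ≤ 1) (q : GaugeField P (j + 1) SU2 → (Free P j → E3) → ℝ)
    (U₁ : GaugeField P (j + 1) SU2 → GaugeField P j SU2) {g₀ : ℝ} (hg : 0 < g₀) (V : GaugeField P (j + 1) SU2)
    (hqm : Measurable (q V)) (hZ : 0 < partZ (volume : Measure (Free P j → E3)) (q V)) :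
    ∫ W, χ (fun b => fluct W b * U₁ V b) * Real.exp (-(S (fun b => fluct W b * U₁ V b))) ∂(fieldMeasure P j SU2) =
      Real.exp (-(S (U₁ V))) * sigma0 ^ Fintype.card (Free P j) * g₀ ^ (3 * Fintype.card (Free P j)) *
        partZ (volume : Measure (Free P j → E3)) (q V) *
        ∫ A, fluctIntegrand S χ q U₁ g₀ V A ∂(normalized (volume : Measure (Free P j → E3)) (q V)) := by
  -- the integrand around the background, as a function of the fluctuation field `U′`
  set F : GaugeField P j SU2 → ℝ := fun U' => χ (fun b => U' b * U₁ V b) * Real.exp (-(S (fun b => U' b * U₁ V b))) with hF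
  have hFm : Measurable F := by
    have hm : Measurable fun U' : GaugeField P j SU2 => (fun b => U' b * U₁ V b) :=
      measurable_pi_iff.mpr fun b => (measurable_pi_apply b).mul measurable_const
    exact (hχm.comp hm).mul (Real.measurable_exp.comp (hSm.comp hm).neg)
  have hFb : ∀ U', |F U'| ≤ 1 := fun U' => by
    rw [hF]; simp only
    rw [abs_mul, Real.abs_exp]
    calc |χ _| * Real.exp (-(S _)) ≤ 1 * 1 := mul_le_mul (hχb _)
          (Real.exp_le_one_iff.mpr (neg_nonpos.mpr (hS0 _))) (Real.exp_pos _).le zero_le_one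
      _ = 1 := one_mul 1
  -- step 1: dummies out + chart on the free bonds
  have hfluct : Measurable fun W : GaugeField P j SU2 => (fluct W : GaugeField P j SU2) := by
    refine measurable_pi_iff.mpr fun b => ?_
    unfold fluct axGlue
    exact (measurable_pi_apply b).comp ((measurable_crossParam hj).comp
      (measurable_const.prodMk (T4TreeGaugeFixing.measurable_fixTo _ _)))
  have hsymm : Measurable fun w : Free P j → SU2 => (splitEquiv (IsDummy (P := P) (j := j))).symm (w, fun _ => (1 : SU2)) :=
    (splitEquiv (IsDummy (P := P) (j := j))).symm.measurable.comp (measurable_id.prodMk measurable_const)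
  have h1 := integral_fluct_su2_eq_integral_chart hj F
    (AveragingRT.integrable_of_abs_le (hFm.comp hfluct) 1 fun W => hFb _)
    (Measurable.aestronglyMeasurable (hFm.comp (hfluct.comp hsymm)))
  -- step 2: the product chart law as a density on the ball-cube; step 3: scaling `A = g₀A′`
  rw [show (fun W => χ (fun b => fluct W b * U₁ V b) * Real.exp (-(S fun b => fluct W b * U₁ V b))) = fun W => F (fluct W) from rfl, h1,
    integral_pi_expMeasure, ← integral_indicator (MeasurableSet.univ_pi fun _ => measurableSet_ball),
    integral_comp_smul_E3 _ hg]
  -- step 4: pointwise identification of the integrand with `e^{−S(U₁)} σ₀^N · e^{−q} · Ψ`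
  have hpt : ∀ A : Free P j → E3,
      (Set.univ.pi fun _ : Free P j => ball (0 : E3) Real.pi).indicator
          (fun A => (∏ i, expWeight (A i)) • F (fluctFree fun i => expPoint (A i))) (g₀ • A)
        = Real.exp (-(S (U₁ V))) * sigma0 ^ Fintype.card (Free P j) *
          (Real.exp (-(q V A)) * fluctIntegrand S χ q U₁ g₀ V A) := fun A => by
    have hFA : F (fluctFree fun i => expPoint ((g₀ • A) i)) =
        χ (fieldAt U₁ g₀ V A) * Real.exp (-(S (fieldAt U₁ g₀ V A))) := rfl
    by_cases hA : g₀ • A ∈ Set.univ.pi fun _ : Free P j => ball (0 : E3) Real.pi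
    · rw [Set.indicator_of_mem hA]
      unfold fluctIntegrand
      rw [Set.indicator_of_mem hA, smul_eq_mul, prod_expWeight_eq, hFA]
      have e1 : Real.exp (-(S (fieldAt U₁ g₀ V A))) = Real.exp (-(S (U₁ V))) * (Real.exp (-(q V A)) *
          Real.exp (-(S (fieldAt U₁ g₀ V A) - S (U₁ V)) + q V A)) := by
        rw [← Real.exp_add, ← Real.exp_add]; congr 1; ring
      rw [e1]; ring
    · rw [Set.indicator_of_notMem hA]
      unfold fluctIntegrand
      rw [Set.indicator_of_notMem hA]
      simp
  simp_rw [hpt]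
  rw [integral_const_mul, integral_exp_neg_mul_eq hqm hZ, smul_eq_mul]
  ring

end Summit.QuantumFields.Balaban3D.Proofs.FluctGaussSU2


end
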